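import Literature.AnabelianGeometry.AbsoluteAnabelian.UnitKummerTransportCanonical
import Literature.AnabelianGeometry.AbsoluteAnabelian.UnitKummerTransportCanonicalTCG
import Literature.AnabelianGeometry.AbsoluteAnabelian.GaloisCyclotomeZHatOne
import HarnessLib

/-!
# [AbsTopIII] Prop 3.3 (i), clause (c): the cyclotome class `μ_Ẑ(M) ⥲ μ_Ẑ(G)` of the presented unit Kummer
# theories read against the GROUP-THEORETIC cyclotome `μ_Ẑ(G_k)` of Cor 1.10 (a) (junction)

S. Mochizuki, *Topics in absolute anabelian geometry III*, §3, Prop. 3.3 (i) p. 73 (bib key `MochizukiAbsTopIII2015`):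
«the natural isomorphism `μ_Ẑ(M) ⥲ μ_Ẑ(G)` [cf. Remark 3.2.1] is only determined up to a `{±1}`- (respectively, `Ẑ^×`-)
multiple if `T = TLG` (respectively, `T = TCG`)»; Rmk. 3.2.1 p. 73: compatibility with «the natural isomorphism of
Corollary 1.10, (a)», i.e. with the GROUP-theoretic cyclotome `μ_Ẑ(G)`.

abc-iut cell, layer L4, row «P33i-CYC-JUNCTION» (abc-iut-L4-lead RULING #6n; seat abc-iut-w4-d009 gen 4).  State of the
tree: abc-iut-L4-t2's model unit Kummer theories (`unitKummerTheoryTLG/TCG`) and their presented transports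
(`TLGPresentation.unitKummerTheory`, `TCGPresentation.unitKummerTheory`, this seat) carry the cyclotome slot
`muG := Λ(k̄ˣ) = Ẑ(1)` — the FIELD-theoretic cyclotome — with the torsor clauses PROVED; abc-iut-L4-t17 / abc-iut-w5-d145's
`TorsionReciprocityData.muZhatEquiv : μ_Ẑ(G_k) ≃* Λ((k^alg)ˣ)` (local class field theory, `nonempty_torsionReciprocityData`)
identifies `Ẑ(1)` with abc-iut-L4-t1's group-theoretic `muZhat G_k`.  This file composes the two:

* `UnitKummerTheory.mapCyclotome U g` — change of the cyclotome target along ANY `g : U.muG ≃* N`: same cohomology and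
  Kummer maps, `cycIsoClass := {e ≫ g}`; the torsor clauses (`{±1}` for `TLG`, `Ẑ^× = Aut Λ(M)` for `TCG`) TRANSPORT
  (they concern automorphisms of the SOURCE `μ_Ẑ(M)` only) — proved in the construction;
* `MLFClosure.cyclotomeUnitsEquivMuZhat C : Λ(k̄ˣ) ≃* μ_Ẑ(G_k)` — `Λ` of the units of `k̄ ≃ₐ[k] k^alg` (`IsAlgClosure.equiv`)
  followed by `(muZhatEquiv)⁻¹` of CHOSEN reciprocity data (`Classical.choice`; any two choices differ by an automorphism of
  `μ_Ẑ(G_k)`, which the torsor clause absorbs for `TCG` and which is the identity-or-inversion question of Prop. 3.3 (ii) for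
  `TLG` — not asserted here);
* **`GaloisMonoidPair.TLGPresentation.unitKummerTheoryMuZhat π`**, **`GaloisMonoidPair.TCGPresentation.unitKummerTheoryMuZhat π`**
  — the presented unit Kummer theories of an ABSTRACT pair with cyclotome target the group-theoretic `μ_Ẑ(G_k)` of the
  presenting field: `muG = muZhat (Field.absoluteGaloisGroup π.C.k)` (`_muG`, rfl), Kummer maps UNCHANGED (`_kummer`, rfl —
  so the naturality / canonicity of `UnitKummerTransportCanonical(TCG).lean` apply verbatim: `unitKummerTheoryMuZhat_canonical`),
  cyclotome class = the composites (`_cycIsoClass`), a `{±1}`- (resp. `Ẑ^×`-) torsor by the structure's proved fields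
  (`unitKummerTheoryMuZhat_torsor`).

HONEST FRAMING: classical (LCFT + Kummer theory at OUR model objects); the `G_k` here is the presenting field's absolute
Galois group `Gal(k^alg/k)`, and the junction isomorphism is chosen, not canonical; nothing here bears on [IUTchIII]
Cor. 3.12; no side taken.
-/

noncomputable section

namespace Literature.AnabelianGeometry.AbsoluteAnabelian

universe u

/-! ### Change of cyclotome target in a unit Kummer theory -/

namespace UnitKummerTheory

variable {T : PairType} {P : GaloisMonoidPair.{u}}

/-- **Change of the cyclotome target** along an isomorphism `g : μ ≃* N`: cohomology and Kummer maps unchanged, the class of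
cyclotome identifications composed with `g`.  The torsor clauses transport because they quantify over automorphisms of the
SOURCE cyclotome `μ_Ẑ(M)` only. [cite: MochizukiAbsTopIII2015, Proposition 3.3 (i) p.73] -/
def mapCyclotome (U : UnitKummerTheory T P) {N : Type u} [CommGroup N] (g : U.muG ≃* N) : UnitKummerTheory T P where
  coh := U.coh
  muG := N
  cycIsoClass := (fun e => e.trans g) '' U.cycIsoClass
  cycIsoClass_nonempty := U.cycIsoClass_nonempty.image _
  cycIsoClass_torsor := by
    rintro _ ⟨e₁, he₁, rfl⟩ _ ⟨e₂, he₂, rfl⟩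
    obtain ⟨v, hv, hcomp⟩ := U.cycIsoClass_torsor e₁ he₁ e₂ he₂
    exact ⟨v, hv, fun ζ => by rw [MulEquiv.trans_apply, MulEquiv.trans_apply, hcomp]⟩
  cycIsoClass_full := by
    rintro _ ⟨e₁, he₁, rfl⟩ v hv
    obtain ⟨e₂, he₂, hcomp⟩ := U.cycIsoClass_full e₁ he₁ v hv
    exact ⟨e₂.trans g, ⟨e₂, he₂, rfl⟩, fun ζ => by rw [MulEquiv.trans_apply, MulEquiv.trans_apply, hcomp]⟩
  kummer := U.kummer
  kummerLim := U.kummerLim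

/-- The cyclotome target of `U.mapCyclotome g` is `N`. [cite: MochizukiAbsTopIII2015, Proposition 3.3 (i) p.73] -/
theorem mapCyclotome_muG (U : UnitKummerTheory T P) {N : Type u} [CommGroup N] (g : U.muG ≃* N) :
    (U.mapCyclotome g).muG = N := rfl

/-- The cohomology data are unchanged. [cite: MochizukiAbsTopIII2015, Proposition 3.3 (i) p.73] -/
theorem mapCyclotome_coh (U : UnitKummerTheory T P) {N : Type u} [CommGroup N] (g : U.muG ≃* N) :
    (U.mapCyclotome g).coh = U.coh := rfl

/-- The Kummer maps are unchanged. [cite: MochizukiAbsTopIII2015, Proposition 3.3 (i) p.73] -/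
theorem mapCyclotome_kummer (U : UnitKummerTheory T P) {N : Type u} [CommGroup N] (g : U.muG ≃* N) :
    (U.mapCyclotome g).kummer = U.kummer := rfl

/-- The colimit Kummer map is unchanged. [cite: MochizukiAbsTopIII2015, Proposition 3.3 (i) p.73] -/
theorem mapCyclotome_kummerLim (U : UnitKummerTheory T P) {N : Type u} [CommGroup N] (g : U.muG ≃* N) :
    (U.mapCyclotome g).kummerLim = U.kummerLim := rfl

/-- The cyclotome class of `U.mapCyclotome g` is `{e ≫ g : e ∈ U.cycIsoClass}`. [cite: MochizukiAbsTopIII2015, Proposition 3.3 (i) p.73] -/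
theorem mapCyclotome_cycIsoClass (U : UnitKummerTheory T P) {N : Type u} [CommGroup N] (g : U.muG ≃* N) :
    (U.mapCyclotome g).cycIsoClass = (fun e => e.trans g) '' U.cycIsoClass := rfl

/-- Membership: `e ≫ g` lies in the new class whenever `e` lies in the old one. [cite: MochizukiAbsTopIII2015, Proposition 3.3 (i) p.73] -/
theorem trans_mem_mapCyclotome_cycIsoClass (U : UnitKummerTheory T P) {N : Type u} [CommGroup N] (g : U.muG ≃* N)
    {e : cyclotome P.M ≃* U.muG} (he : e ∈ U.cycIsoClass) : e.trans g ∈ (U.mapCyclotome g).cycIsoClass :=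
  ⟨e, he, rfl⟩

end UnitKummerTheory

/-! ### `Λ(k̄ˣ) ≃* μ_Ẑ(G_k)`: the field-theoretic cyclotome of a model closure vs the group-theoretic one -/

namespace MLFClosure

variable (C : MLFClosure.{u})

/-- Chosen torsion reciprocity data for `k` (local class field theory: abc-iut-L4-t17's `nonempty_torsionReciprocityData`).
[cite: MochizukiAbsTopIII2015, Cor 1.10 (i) p.42] -/
def reciprocityData : TorsionReciprocityData C.k := Classical.choice (nonempty_torsionReciprocityData C.k)

/-- `k̄ ≃* k^alg` on the chosen closure (`IsAlgClosure.equiv`, as a multiplicative isomorphism).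
[cite: MochizukiAbsTopIII2015, Definition 3.1 (i) p.66] -/
def closureMulEquivAlgClosure : C.K ≃* AlgebraicClosure C.k :=
  (IsAlgClosure.equiv C.k C.K (AlgebraicClosure C.k)).toMulEquiv

/-- **`Λ(k̄ˣ) ≃* μ_Ẑ(G_k)`**: the field-theoretic cyclotome `Ẑ(1) = Λ(k̄ˣ)` of the model closure identified with abc-iut-L4-t1's
GROUP-theoretic cyclotome `μ_Ẑ(G_k)` of `G_k = Gal(k^alg/k)` — `Λ` of the units of `k̄ ≃ k^alg`, then the inverse of
abc-iut-L4-t17's `muZhatEquiv` of the chosen reciprocity data. [cite: MochizukiAbsTopIII2015, Remark 3.2.1 p.73] -/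
def cyclotomeUnitsEquivMuZhat : EtaleTheta.cyclotome (C.K)ˣ ≃* muZhat (Field.absoluteGaloisGroup C.k) :=
  (MonoidKummerTheory.cyclotomeCongr C.closureMulEquivAlgClosure).trans C.reciprocityData.muZhatEquiv.symm

end MLFClosure

/-! ### The presented unit Kummer theories with the group-theoretic cyclotome target -/

namespace GaloisMonoidPair

namespace TLGPresentation

variable {P : GaloisMonoidPair.{0}} (π : P.TLGPresentation)

/-- **The unit Kummer theory of a `TLG` presentation, cyclotome target `μ_Ẑ(G_k)`** (group-theoretic, abc-iut-L4-t1's `muZhat`):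
`π.unitKummerTheory` with its class of identifications `μ_Ẑ(M) ⥲ Λ(k̄ˣ)` composed with `Λ(k̄ˣ) ≃* μ_Ẑ(G_k)`.
[cite: MochizukiAbsTopIII2015, Proposition 3.3 (i) p.73] -/
def unitKummerTheoryMuZhat : UnitKummerTheory .TLG P :=
  π.unitKummerTheory.mapCyclotome π.C.cyclotomeUnitsEquivMuZhat

/-- Its cyclotome target IS `μ_Ẑ(G_k)`. [cite: MochizukiAbsTopIII2015, Proposition 3.3 (i) p.73] -/
theorem unitKummerTheoryMuZhat_muG : π.unitKummerTheoryMuZhat.muG = muZhat (Field.absoluteGaloisGroup π.C.k) := rfl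

/-- Its Kummer maps are those of `π.unitKummerTheory` (so `kummer_natural` / `canonicalEquiv_kummer` of
`UnitKummerTransportCanonical.lean` apply verbatim). [cite: MochizukiAbsTopIII2015, Proposition 3.3 (i) p.73] -/
theorem unitKummerTheoryMuZhat_kummer : π.unitKummerTheoryMuZhat.kummer = π.unitKummerTheory.kummer := rfl

/-- Its colimit Kummer map is that of `π.unitKummerTheory`. [cite: MochizukiAbsTopIII2015, Proposition 3.3 (i) p.73] -/
theorem unitKummerTheoryMuZhat_kummerLim : π.unitKummerTheoryMuZhat.kummerLim = π.unitKummerTheory.kummerLim := rfl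

/-- Its cyclotome class: the composites `μ_Ẑ(M) ⥲ Λ(k̄ˣ) ≃* μ_Ẑ(G_k)`. [cite: MochizukiAbsTopIII2015, Proposition 3.3 (i) p.73] -/
theorem unitKummerTheoryMuZhat_cycIsoClass :
    π.unitKummerTheoryMuZhat.cycIsoClass = (fun e => e.trans π.C.cyclotomeUnitsEquivMuZhat) '' π.unitKummerTheory.cycIsoClass :=
  rfl

/-- **Prop 3.3 (i) clause (c), `TLG`, against the group-theoretic `μ_Ẑ(G_k)`**: any two members of the class of identifications
`μ_Ẑ(M) ⥲ μ_Ẑ(G_k)` differ by `±1` («only determined up to a `{±1}`-multiple»). [cite: MochizukiAbsTopIII2015, Proposition 3.3 (i) p.73] -/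
theorem unitKummerTheoryMuZhat_torsor (e₁ e₂ : cyclotome P.M ≃* muZhat (Field.absoluteGaloisGroup π.C.k))
    (he₁ : e₁ ∈ π.unitKummerTheoryMuZhat.cycIsoClass) (he₂ : e₂ ∈ π.unitKummerTheoryMuZhat.cycIsoClass) :
    ∃ v : cyclotome P.M ≃* cyclotome P.M, (v = MulEquiv.refl _ ∨ v = MulEquiv.inv (cyclotome P.M)) ∧
      ∀ ζ, e₂ ζ = e₁ (v ζ) := by
  obtain ⟨v, hv, h⟩ := π.unitKummerTheoryMuZhat.cycIsoClass_torsor e₁ he₁ e₂ he₂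
  exact ⟨v, hv rfl, h⟩

/-- **Naturality in the presentation**: for two `TLG` presentations of the same pair, the canonical identification of carriers
(`canonicalEquiv`) carries the Kummer classes of `π₁.unitKummerTheoryMuZhat` to those of `π₂.unitKummerTheoryMuZhat`
(the Kummer maps being those of `πᵢ.unitKummerTheory`). [cite: MochizukiAbsTopIII2015, Proposition 3.3 (i) p.73] -/
theorem unitKummerTheoryMuZhat_canonical (π₁ π₂ : P.TLGPresentation) (H : OpenSubgroup P.Pi)
    (m : {m : P.M // ∀ h : H, (h : P.Pi) • m = m}) :
    canonicalEquiv π₁ π₂ H (π₁.unitKummerTheoryMuZhat.kummer H m) = π₂.unitKummerTheoryMuZhat.kummer H m :=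
  canonicalEquiv_kummer π₁ π₂ H m

end TLGPresentation

namespace TCGPresentation

variable {P : GaloisMonoidPair.{0}} (π : P.TCGPresentation)

/-- **The unit Kummer theory of a `TCG` presentation, cyclotome target `μ_Ẑ(G_k)`** (group-theoretic).
[cite: MochizukiAbsTopIII2015, Proposition 3.3 (i) p.73] -/
def unitKummerTheoryMuZhat : UnitKummerTheory .TCG P :=
  π.unitKummerTheory.mapCyclotome π.C.cyclotomeUnitsEquivMuZhat

/-- Its cyclotome target IS `μ_Ẑ(G_k)`. [cite: MochizukiAbsTopIII2015, Proposition 3.3 (i) p.73] -/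
theorem unitKummerTheoryMuZhat_muG : π.unitKummerTheoryMuZhat.muG = muZhat (Field.absoluteGaloisGroup π.C.k) := rfl

/-- Its Kummer maps are those of `π.unitKummerTheory` (so `kummer_natural_intrinsic` / `kummer_eq_push_intrinsic` /
`canonicalIsoIntrinsic_kummerClass` of `UnitKummerTransportCanonicalTCG.lean` apply verbatim).
[cite: MochizukiAbsTopIII2015, Proposition 3.3 (i) p.73] -/
theorem unitKummerTheoryMuZhat_kummer : π.unitKummerTheoryMuZhat.kummer = π.unitKummerTheory.kummer := rfl

/-- Its colimit Kummer map is that of `π.unitKummerTheory`. [cite: MochizukiAbsTopIII2015, Proposition 3.3 (i) p.73] -/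
theorem unitKummerTheoryMuZhat_kummerLim : π.unitKummerTheoryMuZhat.kummerLim = π.unitKummerTheory.kummerLim := rfl

/-- Its cyclotome class: the composites `μ_Ẑ(M) ⥲ Λ(k̄ˣ) ≃* μ_Ẑ(G_k)`. [cite: MochizukiAbsTopIII2015, Proposition 3.3 (i) p.73] -/
theorem unitKummerTheoryMuZhat_cycIsoClass :
    π.unitKummerTheoryMuZhat.cycIsoClass = (fun e => e.trans π.C.cyclotomeUnitsEquivMuZhat) '' π.unitKummerTheory.cycIsoClass :=
  rfl

/-- **Prop 3.3 (i) clause (c), `TCG`, against the group-theoretic `μ_Ẑ(G_k)`**: any two members of the class differ by an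
automorphism of `μ_Ẑ(M)` (`Ẑ^×`), and the class is closed under all of them («only determined up to a `Ẑ^×`-multiple»).
[cite: MochizukiAbsTopIII2015, Proposition 3.3 (i) p.73] -/
theorem unitKummerTheoryMuZhat_torsor :
    (∀ e₁ ∈ π.unitKummerTheoryMuZhat.cycIsoClass, ∀ e₂ ∈ π.unitKummerTheoryMuZhat.cycIsoClass,
      ∃ v : cyclotome P.M ≃* cyclotome P.M, ∀ ζ, e₂ ζ = e₁ (v ζ)) ∧
    (∀ e₁ ∈ π.unitKummerTheoryMuZhat.cycIsoClass, ∀ v : cyclotome P.M ≃* cyclotome P.M,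
      ∃ e₂ ∈ π.unitKummerTheoryMuZhat.cycIsoClass, ∀ ζ, e₂ ζ = e₁ (v ζ)) :=
  ⟨fun e₁ he₁ e₂ he₂ => by
    obtain ⟨v, -, h⟩ := π.unitKummerTheoryMuZhat.cycIsoClass_torsor e₁ he₁ e₂ he₂
    exact ⟨v, h⟩,
  fun e₁ he₁ v => π.unitKummerTheoryMuZhat.cycIsoClass_full e₁ he₁ v (fun h => PairType.noConfusion h)⟩

/-- **Naturality in the presentation** (`TCG`, intrinsic carriers): the comparison isomorphism of two presentations carries the
intrinsic Kummer classes to each other — `canonicalIsoIntrinsic_kummerClass`, unchanged since the Kummer maps are.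
[cite: MochizukiAbsTopIII2015, Proposition 3.3 (i) p.73] -/
theorem unitKummerTheoryMuZhat_kummer_eq_push_intrinsic (H : OpenSubgroup P.Pi) (m : {m : P.M // ∀ h : H, (h : P.Pi) • m = m}) :
    (π.D.inclMorphism π.C).pullH1 (Subgroup.map_id _).le (π.unitKummerTheoryMuZhat.kummer H m) =
      (π.D.inclMorphism π.C).pushH1 (Subgroup.map_id _).le
        (EtaleTheta.kummerClass ((π.comapOpen H : OpenSubgroup π.D.tcgPair.Pi) : Subgroup π.D.Pi)
          (⟨π.unitOf m.1, π.unitOf_smul m.2⟩ :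
            EtaleTheta.invariants (A := (unitSubmonoid π.C.k π.C.K)ˣ)
              ((π.comapOpen H : OpenSubgroup π.D.tcgPair.Pi) : Subgroup π.D.Pi))) :=
  π.kummer_eq_push_intrinsic H m

end TCGPresentation

end GaloisMonoidPair

end Literature.AnabelianGeometry.AbsoluteAnabelian

end
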